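import Literature.AlgebraicGeometry.Motives.HodgeLieCentreDescent
import Literature.AlgebraicGeometry.Motives.HodgeLieCentreOrthogonality
import Literature.AlgebraicGeometry.Motives.HodgeLieRigidityTraceCriterion
import Literature.AlgebraicGeometry.Motives.HodgeLieProductSimpleFactor
import Literature.AlgebraicGeometry.Motives.HodgeStructurePolarizationNormalSemisimple
import HarnessLib

/-!
# Every polarizable `ℚ`-Hodge structure is `Θ`-rigid: the centre of the Hodge Lie algebra is generated, over `ℚ`, by the central
# component of the Hodge operator (Deligne 1982, I Prop. 3.4, Prop. 3.6, Ex. 3.7 (c), §5; Moonen–Zarhin 1999, (3.1))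

Family `hodge`, layer `Literature/AlgebraicGeometry/Motives`.  THEOREMS ONLY (no definition, no named fact).  Written for the
cell `pub-hodgecm2` (COR-CM), seat `b27` gen 55 (count-neutral Mumford–Tate-rank ladder, «the centre», part 5: the theorem).

`H` a POLARIZABLE pure `ℚ`-Hodge structure of weight `n` on a finite-dimensional `V`; `𝔥 = H.hodgeLie` (the rational endomorphisms
whose derivation action kills all Hodge tensors — the Lie algebra of the Hodge group, `Motives/ZarhinHodgeGroupLieAlgebra`); `𝔷 = 𝔥 ∩
End_Hdg(H)` its centre; `Θ` a Hodge operator (`2p − n` on `V^{p,n−p}`).  A «`Θ`-subalgebra» is a bracket-closed rational `𝔞 ⊆ 𝔥`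
whose complex span contains `Θ`; `H` is «`Θ`-RIGID» if every `Θ`-subalgebra is `𝔥`.  Gen 54 (`Motives/HodgeLieRigidModuloCentre`,
`Motives/HodgeLieRigidityTraceCriterion`) reduced rigidity to the centre: `H` is `Θ`-rigid iff `tr(z_ℂ Θ) ≠ 0` for every non-zero
`z ∈ 𝔷`.  This file proves the trace test, hence:

* **`eq_zero_of_mem_center_of_trace_theta_eq_zero`** — `z ∈ 𝔷`, `tr(z_ℂ ∘ Θ) = 0 ⟹ z = 0`.  PROOF (Deligne, LNM 900, I Prop. 3.4 +
  Ex. 3.7 (c) + §5, for the centre, in Lie-algebra form).  `z` is a `ψ`-skew Hodge endomorphism, hence semisimple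
  (`Polarization.isSemisimple_of_isAdjointPair_neg`); take a basis `e_k ∈ Eig_{wt k}(z_ℂ) ∩ V^{deg k, n − deg k}` of `V_ℂ`
  (`exists_basis_mem_eigenspace_inf_piece`), with blocks `λ` of sizes `m_λ` and `Θ`-traces `μ_λ = Σ_{wt k = λ} (2 deg k − n)`.
  (A) `0 = tr(z_ℂ Θ) = Σ_λ m? ` — precisely `Σ_k wt_k θ_k = Σ_λ λ μ_λ`; applying `ρ ∈ Aut(ℂ)` gives `Σ_λ λ μ_{ρλ} = 0`: the eigenvalue
  vector `x = (λ)_λ` is orthogonal to every `Aut(ℂ)`-translate `μ ∘ ρ` of `μ`.  (B) THE ENGINE (`Motives/HodgeLieCentreDescent`): for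
  `w : Λ → ℕ` orthogonal to all `μ ∘ ρ`, the determinant tensor `⊗_λ (det V_λ)^{⊗w_λ}` is a complex combination of rational Hodge
  classes, so `z ∈ 𝔥` kills it: `Σ_λ w_λ m_λ λ = 0`; by scaling and shifting (`tr Θ = tr z = 0`) the same for every RATIONAL `q ⊥ {μ∘ρ}`:
  `(m_λ λ)_λ` is orthogonal to the rational orthogonal complement of `P = ⟨μ ∘ ρ⟩`.  (C) `ℚ^Λ = P ⊕ P^⊥`
  (`Motives/HodgeLieCentreOrthogonality`) gives `Σ_λ m_λ λ² = tr(z²) = 0`, and `tr(z²) < 0` for `0 ≠ z ∈ 𝔷` (Rosati,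
  `AnyWeight.hodgeLie_center_anisotropic`).
* **`hodgeLie_rigid`** — EVERY POLARIZABLE `ℚ`-HODGE STRUCTURE IS `Θ`-RIGID (`rigid_of_forall_center_trace_theta`, gen 54): every
  bracket-closed rational `𝔞 ⊆ 𝔥(H)` whose complex span contains a Hodge operator is `𝔥(H)` (Moonen–Zarhin (3.1) «the smallest
  ℚ-subspace whose ℂ-span contains `h`», for `Lie Hg` of any polarizable Hodge structure, proved from the tensor definition).
* `center_le_of_theta_mem` — every `Θ`-subalgebra contains the centre `𝔷`; `hodgeLie_eq_map_restrict` — for every polarized direct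
  summand `H₁` of `H` (inclusion `ι`, projection `π`), restriction `X ↦ π X ι` maps `𝔥(H)` ONTO `𝔥(H₁)` (Moonen–Zarhin: `Hg(X × Y) → Hg(X)`
  is surjective), via the tree's `hodgeLie_eq_map_restrict_of_rigid` (`Motives/HodgeLieProductSimpleFactor`).

## References
* [Deligne1982HodgeCycles] P. Deligne, *Hodge cycles on abelian varieties*, LNM 900 (1982), I §3 Prop. 3.4, Prop. 3.6, Ex. 3.7 (c), §5.
  [cite: Deligne1982HodgeCycles, I §3 Prop. 3.4, Prop. 3.6 and Example 3.7 (c)]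
* [MoonenZarhin1999LowDim] B. Moonen, Yu. G. Zarhin, Math. Ann. 315 (1999), §3 (3.1) [corpus: paper:arxiv-math_9901113 p. 6].
  [cite: MoonenZarhin1999LowDim, §3 (3.1)]
* [GreenGriffithsKerr2012] M. Green, P. Griffiths, M. Kerr, *Mumford–Tate Groups and Domains* (2012), §I.B (I.B.1), (I.B.5).
  [cite: GreenGriffithsKerr2012, §I.B (I.B.1)]
-/

noncomputable section

open scoped TensorProduct
open Polynomial

namespace Literature.AlgebraicGeometry.Motives

namespace HodgeStructure

universe u

variable {V : Type u} [AddCommGroup V] [Module ℚ V] [Module.Finite ℚ V] [HodgeTensorFacts.{u, u}] {n : ℤ}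

/-! ### §1 Clearing denominators -/

omit [Module.Finite ℚ V] [HodgeTensorFacts.{u, u}] in
/-- A finite family of rationals has a common denominator: `M ∈ ℕ`, `M > 0`, with all `M q_l ∈ ℤ`. [folklore] -/
private theorem exists_nat_mul_eq_int {ι : Type*} [Fintype ι] [DecidableEq ι] (q : ι → ℚ) :
    ∃ M : ℕ, 0 < M ∧ ∀ l, ∃ Z : ℤ, (Z : ℚ) = M * q l := by
  refine ⟨∏ l, (q l).den, Finset.prod_pos fun l _ => (q l).den_pos, fun l => ?_⟩
  refine ⟨(∏ l' ∈ Finset.univ.erase l, ((q l').den : ℤ)) * (q l).num, ?_⟩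
  rw [← Finset.prod_erase_mul _ _ (Finset.mem_univ l)]
  push_cast
  rw [mul_assoc, ← Rat.mul_den_eq_num (q l)]
  ring

/-! ### §2 The centre of the Hodge Lie algebra passes the trace test -/

/-- **The centre of the Hodge Lie algebra is detected by the trace against `Θ`**: for a polarizable Hodge structure `H`, a Hodge
operator `Θ` and `z ∈ 𝔥(H) ∩ End_Hdg(H)`, `tr(z_ℂ ∘ Θ) = 0 ⟹ z = 0`.  (A) the Galois conjugates of `tr(z_ℂ Θ) = 0`, (B) the
determinant Hodge tensors of `Motives/HodgeLieCentreDescent`, (C) double orthogonality `Motives/HodgeLieCentreOrthogonality` and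
`tr(z²) < 0` (Rosati).  Equivalently: `𝔷(𝔥)` is the smallest `ℚ`-subspace whose complexification contains the central component of
`Θ` — Deligne's «`Y(G)` is the `Gal(ℚ̄/ℚ)`-module generated by `μ`» for the connected centre of the Mumford–Tate group of ANY
polarizable Hodge structure. [cite: Deligne1982HodgeCycles, I §3 Prop. 3.4, Prop. 3.6 and Example 3.7 (c)] [cite: MoonenZarhin1999LowDim, §3 (3.1)] -/
theorem eq_zero_of_mem_center_of_trace_theta_eq_zero (H : HodgeStructure V n) (hH : H.IsPolarizable)
    {Θ₀ : Module.End ℂ (ℂ ⊗[ℚ] V)} (hΘ₀ : ∀ p, ∀ x ∈ H.piece p (n - p), Θ₀ x = ((2 * p - n : ℤ) : ℂ) • x)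
    {z : Module.End ℚ V} (hz : z ∈ H.hodgeLie ⊓ Subalgebra.toSubmodule H.endAlg)
    (htr : LinearMap.trace ℂ (ℂ ⊗[ℚ] V) (z.baseChange ℂ * Θ₀) = 0) : z = 0 := by
  classical
  obtain ⟨ψ⟩ := hH
  obtain ⟨hz𝔥, hzE⟩ := Submodule.mem_inf.1 hz
  have hzE' : z ∈ H.endAlg := hzE
  -- `z` is `ψ`-skew, hence semisimple, hence diagonalisable over `ℂ`
  have hadj : LinearMap.IsAdjointPair ψ.form ψ.form z (-z) := by
    intro v w'
    have h := form_apply_add_eq_zero_of_mem_hodgeLie ψ hz𝔥 v w'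
    rw [Pi.neg_apply, map_neg]
    linarith [h]
  have hssQ : z.IsSemisimple := ψ.isSemisimple_of_isAdjointPair_neg hzE' hadj
  have hss : ⨆ μ, Module.End.eigenspace (((⟨z, hzE'⟩ : H.endAlg) : Module.End ℚ V).baseChange ℂ) μ = ⊤ := by
    have hsq : Squarefree ((minpoly ℚ z).map (algebraMap ℚ ℂ)) :=
      (PerfectField.separable_iff_squarefree.mpr hssQ.minpoly_squarefree).map.squarefree
    have haeval : Polynomial.aeval (z.baseChange ℂ) ((minpoly ℚ z).map (algebraMap ℚ ℂ)) = 0 := by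
      rw [Polynomial.aeval_map_algebraMap]
      have h1 := Polynomial.aeval_algHom_apply (Module.End.baseChangeHom ℚ ℂ V) z (minpoly ℚ z)
      rw [minpoly.aeval, map_zero] at h1
      exact h1
    exact (Module.End.isSemisimple_of_squarefree_aeval_eq_zero hsq haeval).iSup_eigenspace_eq_top
  -- an eigenbasis adapted to the Hodge decomposition
  obtain ⟨N, e, wt, deg, he, hcount⟩ := exists_basis_mem_eigenspace_inf_piece H ⟨z, hzE'⟩ hss
  have he' : ∀ k, e k ∈ Module.End.eigenspace (z.baseChange ℂ) (wt k) ⊓ H.piece (deg k) (n - deg k) := he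
  have hcount' : ∀ (μ : ℂ) (p : ℤ), (Finset.univ.filter fun k => wt k = μ ∧ deg k = p).card =
      Module.finrank ℂ ↥(Module.End.eigenspace (z.baseChange ℂ) μ ⊓ H.piece p (n - p)) := hcount
  have hewt : ∀ k, e k ∈ Module.End.eigenspace (z.baseChange ℂ) (wt k) := fun k => (he' k).1
  have hzk : ∀ k, z.baseChange ℂ (e k) = wt k • e k := fun k => Module.End.mem_eigenspace_iff.1 (hewt k)
  have hΘk : ∀ k, Θ₀ (e k) = ((2 * deg k - n : ℤ) : ℂ) • e k := fun k => hΘ₀ (deg k) (e k) (he' k).2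
  -- (0) the trace identities in the basis `e`
  have hθsum : ∑ k, (2 * deg k - n) = 0 := sum_two_mul_deg_sub_eq_zero H z wt deg hcount'
  have hA0 : ∑ k, wt k * (((2 * deg k - n : ℤ) : ℂ)) = 0 := by
    rw [← htr, trace_eq_sum_of_diag e (d := fun k => wt k * (((2 * deg k - n : ℤ) : ℂ)))]
    intro k
    rw [Module.End.mul_apply, hΘk, map_smul, hzk, smul_smul, mul_comm]
  -- the ENGINE, for every admissible multiplicity `w`
  have hB0 : ∀ w : ℂ → ℕ, (∀ ρ : ℂ ≃+* ℂ, ∑ k, (w (ρ.symm (wt k)) : ℤ) * (2 * deg k - n) = 0) →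
      ∑ k, (w (wt k) : ℂ) * wt k = 0 := by
    intro w hw
    have h := sum_mul_repr_baseChange_eq_zero_of_mem_hodgeLie H e wt deg he' w hw hz𝔥 rfl
    simpa only [hzk, map_smul, Finsupp.smul_apply, Module.Basis.repr_self, Finsupp.single_eq_same, smul_eq_mul, mul_one] using h
  have htrz : ∑ k, wt k = 0 := by
    have h := hB0 (fun _ => 1) fun ρ => by simpa only [Nat.cast_one, one_mul] using hθsum
    simpa only [Nat.cast_one, one_mul] using h
  -- the spectrum `S`, its `Aut(ℂ)`-stability, and the regrouping of sums along the blocks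
  set S : Finset ℂ := Finset.univ.image wt with hS
  have hmemS : ∀ (ρ : ℂ ≃+* ℂ) (k : Fin N), ρ.symm (wt k) ∈ S := by
    intro ρ k
    have hcard := card_filter_conj_eq e z wt hewt ρ (ρ.symm (wt k))
    rw [RingEquiv.apply_symm_apply] at hcard
    have hpos : 0 < (Finset.univ.filter fun k' => wt k' = ρ.symm (wt k)).card := by
      rw [← hcard]
      exact Finset.card_pos.2 ⟨k, Finset.mem_filter.2 ⟨Finset.mem_univ _, rfl⟩⟩
    obtain ⟨k', hk'⟩ := Finset.card_pos.1 hpos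
    rw [Finset.mem_filter] at hk'
    rw [hS, Finset.mem_image]
    exact ⟨k', Finset.mem_univ _, hk'.2⟩
  set g : (ℂ ≃+* ℂ) → Fin N → ↥S := fun ρ k => ⟨ρ.symm (wt k), hmemS ρ k⟩ with hg
  have hgfib : ∀ (ρ : ℂ ≃+* ℂ) (l : ↥S) (k : Fin N), g ρ k = l ↔ wt k = ρ l.1 := by
    intro ρ l k
    rw [hg, Subtype.ext_iff]
    dsimp only
    rw [RingEquiv.symm_apply_eq]
  have hfib : ∀ {R : Type} [CommRing R] (ρ : ℂ ≃+* ℂ) (F : ↥S → R) (f : Fin N → R),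
      ∑ k, F (g ρ k) * f k = ∑ l : ↥S, F l * ∑ k ∈ Finset.univ.filter (fun k => wt k = ρ l.1), f k := by
    intro R _ ρ F f
    rw [← Finset.sum_fiberwise Finset.univ (g ρ) fun k => F (g ρ k) * f k]
    refine Finset.sum_congr rfl fun l _ => ?_
    rw [Finset.mul_sum]
    have hfilter : (Finset.univ.filter fun k => g ρ k = l) = Finset.univ.filter fun k => wt k = ρ l.1 := by
      ext k
      simp only [Finset.mem_filter, Finset.mem_univ, true_and, hgfib]
    rw [hfilter]
    refine Finset.sum_congr rfl fun k hk => ?_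
    rw [Finset.mem_filter] at hk
    rw [(hgfib ρ l k).2 hk.2]
  -- the data of the double-orthogonality lemma
  set θ : Fin N → ℤ := fun k => 2 * deg k - n with hθ
  set μ : (ℂ ≃+* ℂ) → ↥S → ℤ := fun ρ l => ∑ k ∈ Finset.univ.filter (fun k => wt k = ρ l.1), θ k with hμ
  set P : Set (↥S → ℚ) := Set.range fun ρ : ℂ ≃+* ℂ => fun l => (μ ρ l : ℚ) with hP
  set m : ↥S → ℚ := fun l => ((Finset.univ.filter fun k => wt k = l.1).card : ℚ) with hm
  -- (A) the eigenvalue vector is orthogonal to `P`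
  have hA : ∀ p ∈ P, ∑ l : ↥S, (p l : ℂ) * l.1 = 0 := by
    rintro _ ⟨ρ, rfl⟩
    have h1 : ∀ l : ↥S, (((μ ρ l : ℚ)) : ℂ) * l.1 =
        (l.1) * ∑ k ∈ Finset.univ.filter (fun k => wt k = ρ l.1), ((θ k : ℤ) : ℂ) := by
      intro l
      rw [hμ, Rat.cast_intCast, Int.cast_sum, mul_comm]
    simp_rw [h1]
    rw [← hfib ρ (fun l => (l.1 : ℂ)) (fun k => ((θ k : ℤ) : ℂ))]
    have h2 : ∑ k, ((g ρ k : ↥S).1 : ℂ) * ((θ k : ℤ) : ℂ) = ρ.symm (∑ k, wt k * ((θ k : ℤ) : ℂ)) := by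
      rw [map_sum]
      refine Finset.sum_congr rfl fun k _ => ?_
      rw [map_mul, map_intCast]
    rw [h2, hθ]
    simp only [] at hA0 ⊢
    rw [hA0, map_zero]
  -- (B) the twisted vector `(m_λ λ)` is orthogonal to the rational orthogonal complement of `P`
  have hB : ∀ q : ↥S → ℚ, (∀ p ∈ P, ∑ l, q l * p l = 0) → ∑ l : ↥S, (q l : ℂ) * ((m l : ℂ) * l.1) = 0 := by
    intro q hq
    have hq' : ∀ ρ : ℂ ≃+* ℂ, ∑ l, q l * (μ ρ l : ℚ) = 0 := fun ρ => hq _ ⟨ρ, rfl⟩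
    obtain ⟨M, hM, hZ⟩ := exists_nat_mul_eq_int q
    choose Z hZ using hZ
    set c : ℕ := ∑ l, (Z l).natAbs with hc
    have hZc : ∀ l, 0 ≤ Z l + c := by
      intro l
      have h1 : -(Z l) ≤ (Z l).natAbs := by
        rw [← Int.natAbs_neg]; exact Int.le_natAbs
      have h2 : (Z l).natAbs ≤ c := by
        rw [hc]
        exact Finset.single_le_sum (f := fun l => (Z l).natAbs) (fun l _ => Nat.zero_le _) (Finset.mem_univ l)
      omega
    set w : ℂ → ℕ := fun x => if h : x ∈ S then (Z ⟨x, h⟩ + c).toNat else 0 with hw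
    have hwS : ∀ l : ↥S, (w l.1 : ℤ) = Z l + c := by
      intro l
      rw [hw]
      dsimp only
      rw [dif_pos l.2, Int.toNat_of_nonneg (hZc l)]
    have hwg : ∀ (ρ : ℂ ≃+* ℂ) (k : Fin N), (w (ρ.symm (wt k)) : ℤ) = Z (g ρ k) + c := fun ρ k => hwS (g ρ k)
    -- the engine's hypothesis for `w`
    have hwhyp : ∀ ρ : ℂ ≃+* ℂ, ∑ k, (w (ρ.symm (wt k)) : ℤ) * (2 * deg k - n) = 0 := by
      intro ρ
      simp_rw [hwg, add_mul, Finset.sum_add_distrib, ← Finset.mul_sum]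
      rw [hθsum, mul_zero, add_zero]
      have hrat : ((∑ k, Z (g ρ k) * (2 * deg k - n) : ℤ) : ℚ) = 0 := by
        push_cast
        have h1 : ∀ k, (Z (g ρ k) : ℚ) * (2 * (deg k : ℚ) - n) = (M : ℚ) * (q (g ρ k) * (θ k : ℚ)) := by
          intro k; rw [hZ, hθ]; push_cast; ring
        simp_rw [h1]
        rw [← Finset.mul_sum, hfib ρ q (fun k => (θ k : ℚ))]
        have h2 : ∀ l : ↥S, q l * ∑ k ∈ Finset.univ.filter (fun k => wt k = ρ l.1), (θ k : ℚ) = q l * (μ ρ l : ℚ) := by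
          intro l; rw [hμ, Int.cast_sum]
        simp_rw [h2]
        rw [hq' ρ, mul_zero]
      exact_mod_cast hrat
    -- the engine's conclusion for `w`, regrouped along the blocks
    have hconcl := hB0 w hwhyp
    have h3 : ∀ k, (w (wt k) : ℂ) = ((Z (g (RingEquiv.refl ℂ) k) : ℤ) : ℂ) + c := by
      intro k
      have h := hwg (RingEquiv.refl ℂ) k
      rw [RingEquiv.symm_refl, RingEquiv.refl_apply] at h
      exact_mod_cast h
    simp_rw [h3, add_mul, Finset.sum_add_distrib, ← Finset.mul_sum] at hconcl
    rw [htrz, mul_zero, add_zero, hfib (RingEquiv.refl ℂ) (fun l => ((Z l : ℤ) : ℂ)) (fun k => wt k)] at hconcl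
    have hinner : ∀ l : ↥S, ∑ k ∈ Finset.univ.filter (fun k => wt k = l.1), wt k =
        ((Finset.univ.filter fun k => wt k = l.1).card : ℂ) * l.1 := by
      intro l
      rw [← nsmul_eq_mul, ← Finset.sum_const]
      exact Finset.sum_congr rfl fun k hk => (Finset.mem_filter.1 hk).2
    have h4 : ∀ l : ↥S, ∑ k ∈ Finset.univ.filter (fun k => wt k = (RingEquiv.refl ℂ) l.1), wt k = (m l : ℂ) * l.1 := by
      intro l
      rw [RingEquiv.refl_apply, hinner, hm, Rat.cast_natCast]
    simp_rw [h4] at hconcl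
    have h5 : ∑ l : ↥S, ((Z l : ℤ) : ℂ) * ((m l : ℂ) * l.1) = (M : ℂ) * ∑ l : ↥S, (q l : ℂ) * ((m l : ℂ) * l.1) := by
      rw [Finset.mul_sum]
      refine Finset.sum_congr rfl fun l _ => ?_
      have : ((Z l : ℤ) : ℂ) = (M : ℂ) * (q l : ℂ) := by exact_mod_cast hZ l
      rw [this, mul_assoc]
    rw [h5] at hconcl
    exact (mul_eq_zero.1 hconcl).resolve_left (by exact_mod_cast hM.ne')
  -- (C) double orthogonality: `Σ_λ m_λ λ² = 0`
  have hC := sum_mul_mul_self_eq_zero_of_orthogonal P m (fun l : ↥S => (l.1 : ℂ)) hA hB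
  -- `tr(z²) = Σ_k wt_k² = Σ_λ m_λ λ² = 0`
  have htr2 : LinearMap.trace ℚ V (z * z) = 0 := by
    have h1 : (algebraMap ℚ ℂ) (LinearMap.trace ℚ V (z * z)) = ∑ k, wt k * wt k := by
      rw [← LinearMap.trace_baseChange, LinearMap.baseChange_mul,
        trace_eq_sum_of_diag e (d := fun k => wt k * wt k)]
      intro k
      rw [Module.End.mul_apply, hzk, map_smul, hzk, smul_smul]
    have hinner : ∀ l : ↥S, ∑ k ∈ Finset.univ.filter (fun k => wt k = l.1), wt k =
        ((Finset.univ.filter fun k => wt k = l.1).card : ℂ) * l.1 := by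
      intro l
      rw [← nsmul_eq_mul, ← Finset.sum_const]
      exact Finset.sum_congr rfl fun k hk => (Finset.mem_filter.1 hk).2
    have h2 : ∑ k, wt k * wt k = ∑ l : ↥S, (m l : ℂ) * (l.1 * l.1) := by
      have h := hfib (RingEquiv.refl ℂ) (fun l => (l.1 : ℂ)) (fun k => wt k)
      have h' : ∀ k, ((g (RingEquiv.refl ℂ) k : ↥S).1 : ℂ) = wt k := fun k => rfl
      simp only [h', RingEquiv.refl_apply] at h
      rw [h]
      refine Finset.sum_congr rfl fun l _ => ?_
      rw [hinner, hm, Rat.cast_natCast]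
      ring
    have h3 : (algebraMap ℚ ℂ) (LinearMap.trace ℚ V (z * z)) = 0 := by rw [h1, h2, hC]
    exact (map_eq_zero_iff (algebraMap ℚ ℂ) (algebraMap ℚ ℂ).injective).1 h3
  exact AnyWeight.hodgeLie_center_anisotropic H ψ z hz𝔥 (fun Y hY => (H.commute_of_mem_hodgeLie hY ⟨z, hzE'⟩).symm) htr2

/-! ### §3 Every polarizable Hodge structure is `Θ`-rigid -/

/-- **EVERY POLARIZABLE `ℚ`-HODGE STRUCTURE IS `Θ`-RIGID**: every bracket-closed rational subspace `𝔞 ⊆ 𝔥(H)` of the Hodge Lie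
algebra whose complex span contains a Hodge operator is all of `𝔥(H)` — `Lie Hg(H)` is the smallest `ℚ`-Lie subalgebra of `End V`
whose complexification contains `Θ = dh(U¹)` (Moonen–Zarhin (3.1): «`Hg` is the smallest algebraic subgroup defined over `ℚ`
containing `h(U¹)`», here for Lie subalgebras, algebraic or not, and for every polarizable Hodge structure of any weight).
The trace test of `rigid_iff_forall_center_trace_theta` is `eq_zero_of_mem_center_of_trace_theta_eq_zero`.
[cite: MoonenZarhin1999LowDim, §3 (3.1)] [cite: Deligne1982HodgeCycles, I §3 Prop. 3.4, Prop. 3.6 and Example 3.7 (c)] -/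
theorem hodgeLie_rigid (H : HodgeStructure V n) (hH : H.IsPolarizable) :
    ∀ 𝔞 : Submodule ℚ (Module.End ℚ V), 𝔞 ≤ H.hodgeLie →
      (∀ X ∈ 𝔞, ∀ Y ∈ 𝔞, X * Y - Y * X ∈ 𝔞) →
      (∃ Θ ∈ Submodule.span ℂ ((fun X : Module.End ℚ V => X.baseChange ℂ) '' (𝔞 : Set (Module.End ℚ V))),
        ∀ p, ∀ x ∈ H.piece p (n - p), Θ x = ((2 * p - n : ℤ) : ℂ) • x) → H.hodgeLie ≤ 𝔞 := by
  intro 𝔞 h𝔞 hbr hΘ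
  obtain ⟨Θ, hΘmem, hΘ'⟩ := hΘ
  exact rigid_of_forall_center_trace_theta H hH hΘ'
    (fun c hc htr => eq_zero_of_mem_center_of_trace_theta_eq_zero H hH hΘ' hc htr) 𝔞 h𝔞 hbr ⟨Θ, hΘmem, hΘ'⟩

/-- Equality form: a `Θ`-subalgebra of `𝔥(H)` IS `𝔥(H)`. [cite: MoonenZarhin1999LowDim, §3 (3.1)] -/
theorem eq_hodgeLie_of_theta_mem (H : HodgeStructure V n) (hH : H.IsPolarizable) (𝔞 : Submodule ℚ (Module.End ℚ V))
    (h𝔞 : 𝔞 ≤ H.hodgeLie) (hbr : ∀ X ∈ 𝔞, ∀ Y ∈ 𝔞, X * Y - Y * X ∈ 𝔞)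
    (hΘ : ∃ Θ ∈ Submodule.span ℂ ((fun X : Module.End ℚ V => X.baseChange ℂ) '' (𝔞 : Set (Module.End ℚ V))),
      ∀ p, ∀ x ∈ H.piece p (n - p), Θ x = ((2 * p - n : ℤ) : ℂ) • x) :
    𝔞 = H.hodgeLie :=
  le_antisymm h𝔞 (hodgeLie_rigid H hH 𝔞 h𝔞 hbr hΘ)

/-! ### §4 Restriction to a polarizable direct summand is surjective on Hodge Lie algebras -/

section Restrict

variable {V₁ : Type u} [AddCommGroup V₁] [Module ℚ V₁] [Module.Finite ℚ V₁] {H₁ : HodgeStructure V₁ n} {H : HodgeStructure V n}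
  (ι : Hom H₁ H) (π : Hom H H₁) (hπι : ∀ v, π.toLinearMap (ι.toLinearMap v) = v)

include hπι in
/-- **`𝔥(H) → 𝔥(H₁)`, `X ↦ π X ι`, is ONTO for every polarizable direct summand `H₁` of `H`** (Moonen–Zarhin: «`Hg(X × Y) → Hg(X)` is
surjective», Lie form, unconditionally): the tree's `hodgeLie_eq_map_restrict_of_rigid` with rigidity supplied by `hodgeLie_rigid`.
[cite: MoonenZarhin1999LowDim, §3 (3.1)] -/
theorem hodgeLie_eq_map_restrict (hH₁ : H₁.IsPolarizable) :
    H₁.hodgeLie = H.hodgeLie.map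
      ((LinearMap.llcomp ℚ V₁ V V₁ π.toLinearMap).comp (LinearMap.lcomp ℚ V ι.toLinearMap)) :=
  hodgeLie_eq_map_restrict_of_rigid ι π hπι (hodgeLie_rigid H₁ hH₁)

include hπι in
/-- Pointwise surjectivity: every `Y ∈ 𝔥(H₁)` is `π X ι` for some `X ∈ 𝔥(H)`. [cite: MoonenZarhin1999LowDim, §3 (3.1)] -/
theorem exists_restrict_eq (hH₁ : H₁.IsPolarizable) {Y : Module.End ℚ V₁} (hY : Y ∈ H₁.hodgeLie) :
    ∃ X ∈ H.hodgeLie, π.toLinearMap ∘ₗ X ∘ₗ ι.toLinearMap = Y :=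
  exists_restrict_eq_of_rigid ι π hπι (hodgeLie_rigid H₁ hH₁) hY

include hπι in
/-- **`dim 𝔥(H₁) ≤ dim 𝔥(H)` for every polarizable direct summand `H₁` of a Hodge structure `H`** (the restriction is onto).
[cite: MoonenZarhin1999LowDim, §3 (3.1)] -/
theorem finrank_hodgeLie_le_of_summand (hH₁ : H₁.IsPolarizable) :
    Module.finrank ℚ H₁.hodgeLie ≤ Module.finrank ℚ H.hodgeLie := by
  rw [hodgeLie_eq_map_restrict ι π hπι hH₁]
  exact Submodule.finrank_map_le _ _

end Restrict

end HodgeStructure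

end Literature.AlgebraicGeometry.Motives

end
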